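import Summits.QuantumAdvantage.QuantumAdvantage.Theorems.CubicForrelationNearExactIsExactTwelveOddWeightLight
import Summits.QuantumAdvantage.QuantumAdvantage.Theorems.CubicForrelationNearExactIsExactQuadWalshPlateau
import Summits.QuantumAdvantage.QuantumAdvantage.Theorems.CubicForrelationNearExactIsExactEightSymplectic

/-!
# Crux `CubicForrelation.NearExactIsExact` (stmt-QuantumAdvantage-14043) — n = 12, WEIGHT OF A TYPE-O CUBIC, IV: a quadratic with `1536` ones
  has a radical of `256` points (RANK 4), is periodic along it, and its polar form is represented by linear forms

Certificate seat `b2b-cforr-cert` (gen 32).  HONEST FRAMING: kernel-checked finite-slice lemmas (standard axioms) preparing case R4 of "a cubic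
Boolean function on 12 bits with weight `≡ 8 (mod 16)` has weight `≥ 1280`" (…TwelveOddWeight*); NOT summit progress, no value of `θ₁₂`.

For a Boolean `q` of degree `≤ 2` on 12 bits with exactly `1536` ones (the light derivative of case R4):
* `tow_quad_lowDeg`: the `𝔽₂`-reading of `q` lies in `lowDeg 12 2`; `tow_B_toZ`, `tow_mem_rad_iff_B`: the tree's Boolean second derivative
  `B(x,d) = q(0) ⊕ q(x) ⊕ q(d) ⊕ q(x⊕d)` is the polar form, and `d` lies in its radical iff `B(·,d) ≡ 0`.
* `tow_rank4_rad`: the radical has exactly `256` points and the dual vector `u⋆` is orthogonal to it (Dickson's theorem in support form,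
  `QuadSampler.walsh_sq_eq`, at the frequency `0`, where `W_q(0) = 4096 − 2·1536 = 1024`).
* `tow_rank4_periodic`: `q(x ⊕ d) = q(x)` for every radical vector `d`.
* `tow_B_form`: `B(·,a)` is the parity `⟨·,c⟩` for some vector `c`; `tow_indep_of_dual`: forms with a dual system of test vectors are independent
  (no non-empty xor vanishes) — the input format of `tow_card_paritySet`.

References: L. E. Dickson (1901) / F. J. MacWilliams, N. J. A. Sloane (1977) Ch. 15 §2 Thm 4–5; C. Carlet (2021) §5.2.  Axioms: the standard three.
-/

set_option linter.dupNamespace false -- D-0017: single-problem summit ⇒ `QuantumAdvantage.QuantumAdvantage` by design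

noncomputable section

namespace Summit.QuantumAdvantage.QuantumAdvantage.Theorems.CubicForrelation.NearExactIsExact

open Finset
open Literature.Computability.QuantumComplexity
open Literature.Computability.QuantumComplexity.BuzetChailloux (bxor zeroVec bxor_bxor_cancel_left bxor_zeroVec zeroVec_bxor bxor_comm
  bxor_self twist_bxor_right twist_zeroVec_right sum_twist_left bxor_eq_zeroVec_iff)
open Literature.Computability.QuantumComplexity.DerivativeWalsh (W twist_bxor_left)
open Literature.Computability.QuantumComplexity.QuadSampler (rad Bd bz zeroV sgnZ ustarV ell mem_rad walsh_sq_eq polar_eq_dotZ ell_eq_dot_ustar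
  bz_zeroV)
open Literature.Computability.QuantumComplexity.QuadPolar (polar toZFun toZFun_apply shift_add_eq_polar toZFun_mem_lowDeg_of_poly)
open Literature.Computability.Complexity.BLR (toZ toZ_xor toZ_injective)
open Literature.Computability.Complexity.F2Elim (dotZ dotZ_zero_left)

/-! ### The `𝔽₂`-reading and the polar form -/

/-- Parity is symmetric in its two arguments. [folklore] -/
theorem tow_parity_comm {m : ℕ} (x z : Fin m → Bool) :
    decide (Odd #(univ.filter fun j => x j && z j)) = decide (Odd #(univ.filter fun j => z j && x j)) := by
  rw [filter_congr fun j _ => by rw [Bool.and_comm]]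

/-- A Boolean function of degree `≤ 2` read in `𝔽₂` lies in `lowDeg n 2`. [cite: Carlet2020, §2.2.1] -/
theorem tow_quad_lowDeg {n : ℕ} (q : (Fin n → Bool) → Bool) (hq : IsDegLeFun 2 q) : toZFun q ∈ CHHL2018.lowDeg n 2 := by
  obtain ⟨p, hp, hpq⟩ := hq
  exact toZFun_mem_lowDeg_of_poly p hp fun x => by rw [hpq x, polyPhase_apply]

/-- The tree's Boolean second derivative is the polar form: `toZ (q 0 ⊕ q x ⊕ q d ⊕ q (x⊕d)) = B_q(x,d)`. [cite: MacWilliamsSloane1977, Ch. 15 §2] -/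
theorem tow_B_toZ {n : ℕ} (q : (Fin n → Bool) → Bool) (x d : Fin n → Bool) :
    toZ (q zeroVec ^^ q x ^^ q d ^^ q (bxor x d)) = polar (toZFun q) x d := by
  unfold polar
  rw [toZ_xor, toZ_xor, toZ_xor]
  simp only [toZFun_apply]
  have e1 : Literature.Computability.Complexity.LowDegree.xorVec x d = bxor x d := rfl
  have e2 : (fun _ : Fin n => false) = (zeroVec : Fin n → Bool) := rfl
  rw [e1, e2]
  ring

/-- **Radical = vanishing Boolean second derivative.** [cite: MacWilliamsSloane1977, Ch. 15 §2] -/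
theorem tow_mem_rad_iff_B {n : ℕ} (q : (Fin n → Bool) → Bool) (hq : IsDegLeFun 2 q) (d : Fin n → Bool) :
    d ∈ rad q ↔ ∀ x, (q zeroVec ^^ q x ^^ q d ^^ q (bxor x d)) = false := by
  have hlow := tow_quad_lowDeg q hq
  rw [mem_rad]
  constructor
  · intro hd x
    have h := polar_eq_dotZ hlow x d
    rw [hd, dotZ_zero_left, ← tow_B_toZ] at h
    revert h
    cases (q zeroVec ^^ q x ^^ q d ^^ q (bxor x d)) <;> decide
  · intro hB
    funext i
    unfold Bd
    rw [← tow_B_toZ, hB]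
    rfl

/-! ### Rank 4 from `1536` ones -/

/-- **Rank 4.**  A quadratic `q` on 12 bits with exactly `1536` ones has a radical of exactly `256` vectors, and `u⋆ ⊥ rad`
(Dickson, support form: `W_q(0)² = 2¹²·#rad·[u⋆ ⊥ rad]` with `W_q(0) = 1024`). [cite: MacWilliamsSloane1977, Ch. 15 §2 Thm 5] -/
theorem tow_rank4_rad (q : (Fin (6 + 6) → Bool) → Bool) (hq : IsDegLeFun 2 q)
    (hw : #(univ.filter fun x : Fin (6 + 6) → Bool => q x = true) = 1536) :
    #(rad q) = 256 ∧ ∀ d ∈ rad q, dotZ (bz (ustarV q)) (bz d) = 0 := by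
  have hlow := tow_quad_lowDeg q hq
  have hsq := walsh_sq_eq hlow zeroV
  have h0 : QuadSampler.walsh q zeroV = 1024 := by
    rw [← qw_W_signOf_eq_walsh, show (zeroV : Fin (6 + 6) → Bool) = zeroVec from rfl, tow_W_zero, hw]; norm_num
  rw [h0, bz_zeroV] at hsq
  simp only [zero_add] at hsq
  split_ifs at hsq with hcond
  · refine ⟨?_, hcond⟩
    norm_num at hsq
    have : ((#(rad q) : ℕ) : ℝ) = 256 := by linarith
    exact_mod_cast this
  · norm_num at hsq

/-- **Periodicity along the radical.**  Under the same hypotheses, `q(x ⊕ d) = q(x)` for every `d ∈ rad q` and every `x`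
(`q(x⊕d) + q(x) = B(x,d) + ℓ(d)` with `B(x,d) = 0` and `ℓ(d) = u⋆·d = 0`). [cite: MacWilliamsSloane1977, Ch. 15 §2] -/
theorem tow_rank4_periodic (q : (Fin (6 + 6) → Bool) → Bool) (hq : IsDegLeFun 2 q)
    (hw : #(univ.filter fun x : Fin (6 + 6) → Bool => q x = true) = 1536) (d : Fin (6 + 6) → Bool) (hd : d ∈ rad q)
    (x : Fin (6 + 6) → Bool) : q (bxor x d) = q x := by
  have hlow := tow_quad_lowDeg q hq
  obtain ⟨-, hstar⟩ := tow_rank4_rad q hq hw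
  have hBd : Bd q d = 0 := mem_rad.1 hd
  have h1 := shift_add_eq_polar (toZFun q) x d
  have h2 : polar (toZFun q) x d = 0 := by rw [polar_eq_dotZ hlow, hBd, dotZ_zero_left]
  have h3 : toZFun q d + toZFun q (fun _ => false) = 0 := by
    have := ell_eq_dot_ustar hlow hBd
    rw [hstar d hd] at this
    exact this
  rw [h2, zero_add, h3] at h1
  have e1 : Literature.Computability.Complexity.LowDegree.xorVec x d = bxor x d := rfl
  rw [e1, toZFun_apply, toZFun_apply] at h1
  have h4 : toZ (q (bxor x d)) = toZ (q x) := by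
    have h5 := eq_neg_of_add_eq_zero_left h1
    rwa [CharTwo.neg_eq] at h5
  exact toZ_injective h4

/-! ### Linear forms representing `B(·, a)` and independence from a dual system -/

/-- **`B(·,a)` is a parity.**  For `q` of degree `≤ 2` and any `a` there is a vector `c` with `B(x,a) = ⟨x,c⟩` for all `x`.
[cite: MacWilliamsSloane1977, Ch. 15 §2] -/
theorem tow_B_form {n : ℕ} (q : (Fin n → Bool) → Bool) (hq : IsDegLeFun 2 q) (a : Fin n → Bool) :
    ∃ c : Fin n → Bool, ∀ x, (q zeroVec ^^ q x ^^ q a ^^ q (bxor x a)) = decide (Odd #(univ.filter fun j => x j && c j)) := by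
  classical
  have hdeg : IsDegLeFun 1 (fun x => (q x ^^ q (bxor x a)) ^^ (q zeroVec ^^ q a)) :=
    bb_isDegLeFun_bxor (stub_derivDegree n 1 q a hq) (isDegLeFun_const 1 _)
  obtain ⟨c, b, hcb⟩ := stub_affineForm n _ hdeg
  have hb : b = false := by
    have h0 := hcb zeroVec
    rw [zeroVec_bxor, twist_zeroVec_right, mul_one] at h0
    revert h0; cases q zeroVec <;> cases q a <;> cases b <;> norm_num [signOf]
  refine ⟨c, fun x => ?_⟩
  have h := hcb x
  rw [hb, vg_twist_eq_signOf, tow_parity_comm c x] at h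
  have e : (q zeroVec ^^ q x ^^ q a ^^ q (bxor x a)) = ((q x ^^ q (bxor x a)) ^^ (q zeroVec ^^ q a)) := by
    cases q zeroVec <;> cases q x <;> cases q a <;> cases q (bxor x a) <;> rfl
  rw [e]
  revert h
  cases ((q x ^^ q (bxor x a)) ^^ (q zeroVec ^^ q a)) <;> cases decide (Odd #(univ.filter fun j => x j && c j)) <;>
    norm_num [signOf]

/-- **Independence from a dual system.**  If forms `z₀,…,z_{k−1}` have test vectors `t₀,…,t_{k−1}` with `⟨t_j, z_i⟩ = [i = j]`, then no
non-empty xor of the `zᵢ` vanishes (the hypothesis format of `tow_card_paritySet`). [folklore] -/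
theorem tow_indep_of_dual {m k : ℕ} (z t : Fin k → Fin m → Bool)
    (h : ∀ i j, decide (Odd #(univ.filter fun l => t j l && z i l)) = decide (i = j)) (ε : Fin k → Bool) (hε : ε ≠ fun _ => false) :
    (fun l => (zeroVec : Fin m → Bool) l ^^ decide (Odd #(univ.filter fun i => ε i && z i l))) ≠ zeroVec := by
  classical
  obtain ⟨i, hi⟩ : ∃ i, ε i = true := by
    by_contra hno; push Not at hno
    exact hε (funext fun i => by simpa using hno i)
  intro h0
  have h1 := ed_twist_flatPt zeroVec z ε (t i)
  rw [h0, Literature.Computability.QuantumComplexity.twist_comm zeroVec (t i), twist_zeroVec_right, one_mul] at h1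
  have h2 : ∀ j, twist (z j) (t i) = if j = i then -1 else 1 := by
    intro j
    rw [vg_twist_eq_signOf, tow_parity_comm (z j) (t i), h j i]
    by_cases hji : j = i
    · rw [if_pos hji]; simp [hji, signOf]
    · rw [if_neg hji]; simp [hji, signOf]
  simp_rw [h2] at h1
  rw [prod_eq_single i (fun j _ hji => by rw [if_neg hji]; split_ifs <;> rfl) (fun hi' => absurd (mem_univ i) hi'), hi] at h1
  norm_num at h1

end Summit.QuantumAdvantage.QuantumAdvantage.Theorems.CubicForrelation.NearExactIsExact

end
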